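/- Copyright: ym3-torus cell, WIDTH seat `ym-ust-19936-w7` (prover, g9), for crux `HistoryTailL` (stmt-QuantumFields-19936),
level-0 infrastructure (T4-LOW, part 1) of LINE `local_insertion` (#13) ∕ K1.  Released under the licence of the surrounding project. -/
import Summits.QuantumFields.YangMills.Theorems.LocalInsertionTorusTreeGaugeLowerBound
import Literature.MathematicalPhysics.QuantumFieldTheory.LatticeGaugeProofs
import HarnessLib

/-!
# Lemma 9.3 on the torus, full strength: the gauge-fixed off-comb links are i.i.d. Haar, and the Wilson integral in the comb gauge

Support file (`--supports stmt-QuantumFields-19936 --as helper`), first brick of «(T4) UNIFORM DOUBLING, general d» (LEAD ★w1-19936 g7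
00:35:51Z (2) GO; the γ-uniform cure of the `β^{c/L}` residual of the level-0 sandwich, template = the `d = 4` files
✓`…LangevinControlUVFemtoCurvatureTwoPointC{SkewHaar,TorusLower,TorusLowerAxis}` of route `LangevinControlUV`), companion of ✓p682361
`…LocalInsertionTorusTreeGaugeLowerBound` (whose `measureReal_forall_gaugeFixed_mem_eq` is the equal-box special case of §1 here).

Letters (spelled out, no definition): the torus comb `tc e := (∀ k, e.2 < k → e.1 k = 0) ∧ (e.1 e.2).val + 1 < L`, its complement
`E_free := univ.filter (¬ tc)`, the comb gauge `G_U(y) := combGauge (ofTorus U) ŷ` and the gauge-fixed configuration `U^{G_U} := gaugeTransform G_U U`.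

* §1 `measureReal_forall_gaugeFixed_mem_eq_prod` — boxes with a different side per edge: `π{∀ e ∈ E_free, U^{G_U}(e) ∈ B_e} = ∏ Haar(B_e)`;
  ★ `map_gaugeFixed_eq_pi` — THE PUSH-FORWARD: the law of `(U^{G_U}(e))_{e ∈ E_free}` under product Haar is product Haar on `G^{E_free}`
  ([Chatterjee2016] Lemma 9.3; `d = 4` twin ✓`FemtoCurvatureTwoPointC.TorusGauge.map_combSection_pi_haar`).
* §2 `gaugeTransform_comb_eq_extend` — `U^{G_U}` IS the extension by `1` (on the comb) of its off-comb values (`Function.extend Subtype.val`);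
  ★★ `lintegral_eq_lintegral_pi_gaugeFixed` — for every measurable gauge-invariant `Φ ≥ 0`,
  `∫ Φ dπ = ∫_{G^{E_free}} Φ(extend W 1) dHaar^{⊗E_free}(W)`; ★★ `lintegral_boltzmann_eq_pi_gaugeFixed` — the Wilson–Boltzmann case
  `Z_{Λ_L}(β) = ∫_{G^{E_free}} e^{−β S(extend W 1)} dHaar^{⊗ E_free}(W)` (`d = 4` twin ✓`partitionFunction_eq_lintegral_combGauge`).

HONEST SCOPE.  Folklore gauge fixing ([Chatterjee2016] §9; M. Creutz, *Quarks, gluons and lattices* Ch. 9); nothing of LINE #13's stubs, of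
`HistoryTailL`, of any crux is proved.  YM₃ on T³ is rung R3 — not d = 4, not infinite volume, not a mass gap, not Clay.  THEOREMS ONLY
(0 `def`, 0 `sorry`); count-neutral.
-/

noncomputable section

open MeasureTheory Finset Function
open scoped ENNReal

namespace Summit.QuantumFields.YangMills.Theorems.LocalInsertion.TorusTreeGauge

open Literature.MathematicalPhysics.QuantumFieldTheory
open Literature.MathematicalPhysics.QuantumFieldTheory.AxialGauge
open Summit.QuantumFields.YangMills.Theorems.LocalInsertion.TriangularHaar (integral_prod_words_eq)

variable {d L : ℕ} [NeZero L] [Fact (1 < L)]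
variable {G : Type*} [Group G] [TopologicalSpace G] [IsTopologicalGroup G] [CompactSpace G]
  [MeasurableSpace G] [BorelSpace G] [SecondCountableTopology G]

/-! ## §1 Boxes with a side per edge, and the push-forward -/

omit [Fact (1 < L)] in
/-- **Lemma 9.3 on the torus, boxes with a different side per edge**: for measurable `B_e ⊆ G`,
`π{U | ∀ e ∈ E_free, U^{G_U}(e) ∈ B_e} = ∏_{e ∈ E_free} Haar(B_e)`. [cite: Chatterjee2016, Lemma 9.3] -/
theorem measureReal_forall_gaugeFixed_mem_eq_prod {B : Edge d L → Set G} (hBm : ∀ e, MeasurableSet (B e)) :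
    (Measure.pi fun _ : Edge d L => haarProbability G).real
        {U : GaugeConfig d L G | ∀ e ∈ (Finset.univ : Finset (Edge d L)).filter
            (fun e => ¬ ((∀ k : Fin d, e.2 < k → e.1 k = 0) ∧ (e.1 e.2).val + 1 < L)),
          gaugeTransform (fun y : Site d L => combGauge (ZdGaugeConfig.ofTorus U) (fun k => ((y k).val : ℤ))) U e ∈ B e} =
      ∏ e ∈ (Finset.univ : Finset (Edge d L)).filter
          (fun e => ¬ ((∀ k : Fin d, e.2 < k → e.1 k = 0) ∧ (e.1 e.2).val + 1 < L)),
        (haarProbability G).real (B e) := by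
  classical
  set π : Measure (GaugeConfig d L G) := Measure.pi fun _ : Edge d L => haarProbability G with hπ
  set tc : Edge d L → Prop := fun e => (∀ k : Fin d, e.2 < k → e.1 k = 0) ∧ (e.1 e.2).val + 1 < L with htc
  set F : Finset (Edge d L) := (Finset.univ : Finset (Edge d L)).filter fun e => ¬ tc e with hF
  set Gg : GaugeConfig d L G → Site d L → G :=
    fun U y => combGauge (ZdGaugeConfig.ofTorus U) (fun k => ((y k).val : ℤ)) with hGg
  set A : Set (GaugeConfig d L G) := {U | ∀ e ∈ F, gaugeTransform (Gg U) U e ∈ B e} with hA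
  have hAm : MeasurableSet A := by
    have : A = ⋂ e ∈ F, (fun U => gaugeTransform (Gg U) U e) ⁻¹' B e := by ext U; simp [hA]
    rw [this]
    exact MeasurableSet.biInter (Set.to_countable _) fun e _ => measurable_gaugeTransform_comb e (hBm e)
  have hindA : ∀ U : GaugeConfig d L G,
      (∏ e ∈ F, (B e).indicator (1 : G → ℝ) (Gg U e.1 * U e * (Gg U (e.1.shift e.2))⁻¹)) = A.indicator 1 U := by
    intro U
    by_cases hU : U ∈ A
    · rw [Set.indicator_of_mem hU, Pi.one_apply]
      exact Finset.prod_eq_one fun e he => by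
        rw [Set.indicator_of_mem (show Gg U e.1 * U e * (Gg U (e.1.shift e.2))⁻¹ ∈ B e from hU e he), Pi.one_apply]
    · rw [Set.indicator_of_notMem hU]
      simp only [hA, Set.mem_setOf_eq, not_forall] at hU
      obtain ⟨e, he, hne⟩ := hU
      have hne' : Gg U e.1 * U e * (Gg U (e.1.shift e.2))⁻¹ ∉ B e := hne
      exact Finset.prod_eq_zero he (by rw [Set.indicator_of_notMem hne'])
  have hGdep : ∀ e ∈ F, ∀ z : Site d L,
      DependsOn (fun U : GaugeConfig d L G => Gg U z) {j : Edge d L | j ≠ e ∧ (j ∈ F → (0 : ℕ) < 0)} := by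
    intro e he z U V hUV
    have he' : ¬ tc e := by simpa [hF] using he
    refine combGauge_congr_of_comb (fun j hj => hUV j ⟨?_, fun hjF => ?_⟩) z
    · rintro rfl; exact he' hj
    · exact absurd hj (Finset.mem_filter.1 hjF).2
  have hprod := integral_prod_words_eq (ι := Edge d L) (haarProbability G) (fun _ => (0 : ℕ)) F
    (a := fun e U => Gg U e.1) (b := fun e U => (Gg U (e.1.shift e.2))⁻¹)
    (fun e => measurable_combGauge_ofTorus e.1) (fun e => (measurable_combGauge_ofTorus _).inv)
    (fun e he => ⟨hGdep e he e.1, fun U V hUV => by simp only [hGdep e he (e.1.shift e.2) hUV]⟩)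
    (w := fun e => (B e).indicator (1 : G → ℝ)) (fun e => measurable_one.indicator (hBm e))
    (fun _ g => Set.indicator_nonneg (fun _ _ => zero_le_one) g) (B := 1)
    (fun _ g => Set.indicator_apply_le' (fun _ => le_rfl) (fun _ => zero_le_one))
  simp only [hindA] at hprod
  rw [integral_indicator_one hAm] at hprod
  rw [hprod]
  exact Finset.prod_congr rfl fun e _ => integral_indicator_one (hBm e)

omit [Fact (1 < L)] [CompactSpace G] in
/-- The vector of gauge-fixed off-comb variables is a measurable function of the configuration. [folklore] -/
theorem measurable_gaugeFixed_restrict :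
    Measurable fun (U : GaugeConfig d L G)
        (i : ↥((Finset.univ : Finset (Edge d L)).filter
          (fun e => ¬ ((∀ k : Fin d, e.2 < k → e.1 k = 0) ∧ (e.1 e.2).val + 1 < L)))) =>
      gaugeTransform (fun y : Site d L => combGauge (ZdGaugeConfig.ofTorus U) (fun k => ((y k).val : ℤ))) U i.1 :=
  measurable_pi_lambda _ fun i => measurable_gaugeTransform_comb i.1

omit [Fact (1 < L)] in
/-- ★ **THE PUSH-FORWARD (Lemma 9.3 on the torus, full strength)**: under product Haar on the torus, the gauge-fixed off-comb variables
`(U^{G_U}(e))_{e ∈ E_free}` are INDEPENDENT AND HAAR-DISTRIBUTED — their joint law is product Haar on `G^{E_free}`.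
[cite: Chatterjee2016, Lemma 9.3] -/
theorem map_gaugeFixed_eq_pi :
    Measure.map (fun (U : GaugeConfig d L G)
        (i : ↥((Finset.univ : Finset (Edge d L)).filter
          (fun e => ¬ ((∀ k : Fin d, e.2 < k → e.1 k = 0) ∧ (e.1 e.2).val + 1 < L)))) =>
          gaugeTransform (fun y : Site d L => combGauge (ZdGaugeConfig.ofTorus U) (fun k => ((y k).val : ℤ))) U i.1)
        (Measure.pi fun _ : Edge d L => haarProbability G) =
      Measure.pi fun _ : ↥((Finset.univ : Finset (Edge d L)).filter
          (fun e => ¬ ((∀ k : Fin d, e.2 < k → e.1 k = 0) ∧ (e.1 e.2).val + 1 < L))) => haarProbability G := by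
  classical
  set π : Measure (GaugeConfig d L G) := Measure.pi fun _ : Edge d L => haarProbability G with hπ
  set tc : Edge d L → Prop := fun e => (∀ k : Fin d, e.2 < k → e.1 k = 0) ∧ (e.1 e.2).val + 1 < L with htc
  set F : Finset (Edge d L) := (Finset.univ : Finset (Edge d L)).filter fun e => ¬ tc e with hF
  set Gg : GaugeConfig d L G → Site d L → G :=
    fun U y => combGauge (ZdGaugeConfig.ofTorus U) (fun k => ((y k).val : ℤ)) with hGg
  symm
  refine Measure.pi_eq fun s hs => ?_
  rw [Measure.map_apply measurable_gaugeFixed_restrict (MeasurableSet.univ_pi fun i => hs i)]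
  -- the box pulled back to the torus: side `B e = s ⟨e, _⟩` on `E_free`, `univ` elsewhere
  set B : Edge d L → Set G := fun e => if h : e ∈ F then s ⟨e, h⟩ else Set.univ with hB
  have hBm : ∀ e, MeasurableSet (B e) := fun e => by
    by_cases h : e ∈ F
    · simp only [hB, dif_pos h]; exact hs _
    · simp only [hB, dif_neg h]; exact MeasurableSet.univ
  have hpre : (fun (U : GaugeConfig d L G) (i : ↥F) => gaugeTransform (Gg U) U i.1) ⁻¹' Set.pi Set.univ s =
      {U : GaugeConfig d L G | ∀ e ∈ F, gaugeTransform (Gg U) U e ∈ B e} := by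
    ext U
    simp only [Set.mem_preimage, Set.mem_univ_pi, Set.mem_setOf_eq]
    constructor
    · intro h e he
      simp only [hB, dif_pos he]
      exact h ⟨e, he⟩
    · intro h i
      have := h i.1 i.2
      simp only [hB, dif_pos i.2] at this
      exact this
  rw [hpre]
  have hreal := measureReal_forall_gaugeFixed_mem_eq_prod (d := d) (L := L) (G := G) hBm
  have hof : π {U : GaugeConfig d L G | ∀ e ∈ F, gaugeTransform (Gg U) U e ∈ B e} =
      ENNReal.ofReal (π.real {U : GaugeConfig d L G | ∀ e ∈ F, gaugeTransform (Gg U) U e ∈ B e}) :=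
    (ofReal_measureReal (measure_ne_top _ _)).symm
  rw [hof, hreal, ENNReal.ofReal_prod_of_nonneg fun e _ => measureReal_nonneg]
  simp only [ofReal_measureReal (measure_ne_top _ _)]
  -- reindex `∏_{e ∈ F} Haar(B e) = ∏_{i : ↥F} Haar(s i)`
  rw [← Finset.prod_coe_sort F]
  exact Finset.prod_congr rfl fun i _ => by simp only [hB, dif_pos i.2]

/-! ## §2 The Wilson integral in the comb gauge -/

omit [TopologicalSpace G] [IsTopologicalGroup G] [CompactSpace G] [MeasurableSpace G] [BorelSpace G]
  [SecondCountableTopology G] in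
/-- **`U^{G_U}` is the extension by `1` of its off-comb values**: on the comb `U^{G_U} = 1` (✓`gaugeTransform_comb_eq_one`), so
`U^{G_U} = Function.extend Subtype.val (U^{G_U}|_{E_free}) 1`. [cite: Chatterjee2016, Prop. 9.2] -/
theorem gaugeTransform_comb_eq_extend (U : GaugeConfig d L G) :
    gaugeTransform (fun y : Site d L => combGauge (ZdGaugeConfig.ofTorus U) (fun k => ((y k).val : ℤ))) U =
      Function.extend (Subtype.val : ↥((Finset.univ : Finset (Edge d L)).filter
          (fun e => ¬ ((∀ k : Fin d, e.2 < k → e.1 k = 0) ∧ (e.1 e.2).val + 1 < L))) → Edge d L)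
        (fun i => gaugeTransform (fun y : Site d L => combGauge (ZdGaugeConfig.ofTorus U) (fun k => ((y k).val : ℤ))) U i.1)
        1 := by
  classical
  funext e
  by_cases he : (∀ k : Fin d, e.2 < k → e.1 k = 0) ∧ (e.1 e.2).val + 1 < L
  · have hnot : ¬ ∃ i : ↥((Finset.univ : Finset (Edge d L)).filter
        (fun e => ¬ ((∀ k : Fin d, e.2 < k → e.1 k = 0) ∧ (e.1 e.2).val + 1 < L))), (Subtype.val i) = e := by
      rintro ⟨i, rfl⟩
      exact (Finset.mem_filter.1 i.2).2 he
    rw [Function.extend_apply' _ _ _ hnot, Pi.one_apply]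
    obtain ⟨x, i⟩ := e
    exact gaugeTransform_comb_eq_one U he.1 he.2
  · have hmem : e ∈ (Finset.univ : Finset (Edge d L)).filter
        (fun e => ¬ ((∀ k : Fin d, e.2 < k → e.1 k = 0) ∧ (e.1 e.2).val + 1 < L)) := Finset.mem_filter.2 ⟨Finset.mem_univ _, he⟩
    have := Subtype.val_injective.extend_apply
      (fun i : ↥((Finset.univ : Finset (Edge d L)).filter
          (fun e => ¬ ((∀ k : Fin d, e.2 < k → e.1 k = 0) ∧ (e.1 e.2).val + 1 < L))) =>
        gaugeTransform (fun y : Site d L => combGauge (ZdGaugeConfig.ofTorus U) (fun k => ((y k).val : ℤ))) U i.1)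
      (1 : Edge d L → G) ⟨e, hmem⟩
    rw [this]

omit [NeZero L] [Fact (1 < L)] [TopologicalSpace G] [IsTopologicalGroup G] [CompactSpace G] [BorelSpace G]
  [SecondCountableTopology G] in
/-- The extension-by-one map `G^{E_free} → G^{E}` is measurable. [folklore] -/
theorem measurable_extend_one (F : Finset (Edge d L)) :
    Measurable fun W : ↥F → G => Function.extend (Subtype.val : ↥F → Edge d L) W (1 : Edge d L → G) := by
  classical
  refine measurable_pi_lambda _ fun e => ?_
  by_cases he : e ∈ F
  · have : (fun W : ↥F → G => Function.extend (Subtype.val : ↥F → Edge d L) W (1 : Edge d L → G) e) =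
        fun W => W ⟨e, he⟩ := by
      funext W; exact Subtype.val_injective.extend_apply W (1 : Edge d L → G) ⟨e, he⟩
    rw [this]; exact measurable_pi_apply _
  · have hnot : ¬ ∃ i : ↥F, (Subtype.val i) = e := by rintro ⟨i, rfl⟩; exact he i.2
    have : (fun W : ↥F → G => Function.extend (Subtype.val : ↥F → Edge d L) W (1 : Edge d L → G) e) = fun _ => 1 := by
      funext W; rw [Function.extend_apply' _ _ _ hnot, Pi.one_apply]
    rw [this]; exact measurable_const

/-- ★★ **THE INTEGRAL OF A GAUGE-INVARIANT FUNCTION IN THE COMB GAUGE.**  For every measurable gauge-invariant `Φ ≥ 0`,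
`∫ Φ dπ = ∫_{G^{E_free}} Φ(extend W 1) dHaar^{⊗E_free}(W)`: gauge-fix every configuration with its own comb gauge (`Φ` does not
change), then push forward by `map_gaugeFixed_eq_pi`. [cite: Chatterjee2016, Lemma 9.3] -/
theorem lintegral_eq_lintegral_pi_gaugeFixed {Φ : GaugeConfig d L G → ℝ≥0∞} (hΦ : Measurable Φ)
    (hinv : ∀ (g : Site d L → G) (U : GaugeConfig d L G), Φ (gaugeTransform g U) = Φ U) :
    ∫⁻ U, Φ U ∂(Measure.pi fun _ : Edge d L => haarProbability G) =
      ∫⁻ W, Φ (Function.extend (Subtype.val : ↥((Finset.univ : Finset (Edge d L)).filter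
          (fun e => ¬ ((∀ k : Fin d, e.2 < k → e.1 k = 0) ∧ (e.1 e.2).val + 1 < L))) → Edge d L) W 1)
        ∂(Measure.pi fun _ : ↥((Finset.univ : Finset (Edge d L)).filter
          (fun e => ¬ ((∀ k : Fin d, e.2 < k → e.1 k = 0) ∧ (e.1 e.2).val + 1 < L))) => haarProbability G) := by
  have h := lintegral_map (μ := Measure.pi fun _ : Edge d L => haarProbability G) (hΦ.comp (measurable_extend_one _))
    (measurable_gaugeFixed_restrict (d := d) (L := L) (G := G))
  simp only [Function.comp] at h
  rw [← map_gaugeFixed_eq_pi (d := d) (L := L) (G := G), h]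
  refine lintegral_congr fun U => ?_
  rw [← gaugeTransform_comb_eq_extend U, hinv]

variable {m : ℕ} (ρ : G →* Matrix (Fin m) (Fin m) ℂ)

/-- ★★ **THE WILSON PARTITION INTEGRAL IN THE COMB GAUGE**: `∫ e^{−βS(U)} dπ(U) = ∫_{G^{E_free}} e^{−βS(extend W 1)} dHaar^{⊗E_free}(W)`.
[cite: Chatterjee2016, Lemma 9.3] -/
theorem lintegral_boltzmann_eq_pi_gaugeFixed (hρc : Continuous ρ) (β : ℝ) :
    ∫⁻ U, ENNReal.ofReal (Real.exp (-β * wilsonAction ρ U)) ∂(Measure.pi fun _ : Edge d L => haarProbability G) =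
      ∫⁻ W, ENNReal.ofReal (Real.exp (-β * wilsonAction ρ
          (Function.extend (Subtype.val : ↥((Finset.univ : Finset (Edge d L)).filter
            (fun e => ¬ ((∀ k : Fin d, e.2 < k → e.1 k = 0) ∧ (e.1 e.2).val + 1 < L))) → Edge d L) W 1)))
        ∂(Measure.pi fun _ : ↥((Finset.univ : Finset (Edge d L)).filter
          (fun e => ¬ ((∀ k : Fin d, e.2 < k → e.1 k = 0) ∧ (e.1 e.2).val + 1 < L))) => haarProbability G) :=
  lintegral_eq_lintegral_pi_gaugeFixed
    (ENNReal.measurable_ofReal.comp (Real.measurable_exp.comp ((measurable_wilsonAction ρ hρc).const_mul _)))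
    fun g U => by rw [wilsonAction_gaugeTransform]

end Summit.QuantumFields.YangMills.Theorems.LocalInsertion.TorusTreeGauge

end
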